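/-
Copyright (c) 2026 the pub-hodgecm-mathlib formalisation cell (harness21).  Prover seat hodgecm-mathlib-A-p12 (g35): P6b wave A seat 1 «FFGS-QUOT» (A), §C
«THE BASIS ∕ TORSOR CRITERION» (dealer desk F0P6b-plan (g13) DEAL P6b-A1, director g34 s1734; box F0P6-ref1 (g8)), 2026-09-03.
-/
import Literature.AlgebraicGeometry.GroupSchemes.FiniteFlatGroupSchemeQuotientAffineIntegral
import Mathlib.RingTheory.Flat.FaithfullyFlat.Basic
import HarnessLib

/-!
# Quotient of an affine scheme by a finite locally free group scheme, §C: the basis criterion (Stacks 03C8 in Hopf form)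

Topic `AlgebraicGeometry/GroupSchemes`; namespace `Literature.AlgebraicGeometry.GroupSchemes.FiniteFlatQuotientAffine` (sub-namespace = the object:
the affine quotient `X ⧸ Z = Spec C₀` of [MumfordAV1970] §12 Thm. 1 ∕ [SGA3I] Exp. V Thm. 4.1 ∕ [StacksProject] Tag 03BM); THEOREMS ONLY (no definition,
instance, notation or named fact); Mathlib-footed, over §A (`…QuotientAffineTwist`: the Galois twist) and §B (`…QuotientAffineIntegral`: the counit
section `rid_comp_map_counit_apply`, `galoisTwist_map_includeLeft`).  Cell `pub/hodgecm-mathlib` (D-0151), organ «FFGS-QUOT» (A) (desk F0P6b-plan (g13)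
sheet §0; signature sheet `WAVEA-SIGNATURES.v2` `sig_FFGSQ_A_torsorOverInvariants`), lane `--supports stmt-HodgeConjecture-24832`; count-neutral (banked
Row-4B capital).  HC_CM is proved only modulo the printed citations (2 remaining named inputs hLiu418 = `stmt-HodgeConjecture-24832`, h413 =
`stmt-HodgeConjecture-24833`) until rung 0 closes.

THE SETTING (the signature sheet's, VERBATIM).  `R` a commutative ring, `H` a COMMUTATIVE Hopf algebra over `R` (ANY — no finiteness in this file), `C` a
commutative `R`-algebra with a right coaction `ρ : C →ₐ[R] C ⊗[R] H`, `hcoassoc : ∀ c, map id comul (ρ c) = assoc (map ρ id (ρ c))`,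
`hcounit : ∀ c, rid (map id counit (ρ c)) = c`; invariants `C₀ := AlgHom.equalizer ρ includeLeft`; Galois map `θ := productMap includeLeft ρ : C ⊗[R] C →
C ⊗[R] H` (`a ⊗ b ↦ (a ⊗ 1)·ρ b`, the graph `Z × X → X × X`).

THE CRITERION ([StacksProject] Lemma 03C8 «if `B = ⨁ s♯(A) t♯(xᵢ)` then `A = ⨁ C xᵢ` and `B ≅ A ⊗_C A`», for the groupoid `X × Z ⇉ X` of an action,
`s♯ = includeLeft`, `t♯ = ρ`).  HYPOTHESIS: a family `x : ι → C` and a `C`-basis `β` of `C ⊗[R] H` (the LEFT `C`-module structure) with `β i = ρ (x i)`.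
CONCLUSIONS:
* `repr_coaction_mem_equalizer` — the coordinates of any `ρ c` in the basis `ρ (x i)` lie in `C₀` (apply `ρ ⊗ id` and `id ⊗ Δ` to the expansion: they agree
  on `ρ c` by `hcoassoc`, and `(ρ ⊗ id)(ρ (x i)) = T ((includeLeft ⊗ id)(ρ (x i)))` is a `D`-basis of `D ⊗ H`, `D = C ⊗ H` — the base change of `β`
  along `includeLeft` twisted by the Galois automorphism `T` of §A (`exists_basis_map_includeLeft`, `exists_basis_map_coaction`));
* `eq_sum_repr_coaction_mul` — `c = Σᵢ (β.repr (ρ c) i) · x i` (apply the counit section);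
* `span_invariants_range_eq_top`, `linearIndependent_invariants`, **`exists_basis_invariants` — `x` is a `C₀`-BASIS of `C`**, hence `free_invariants_of_basis`,
  `finite_invariants_of_basis` (finite `ι`), **`faithfullyFlat_invariants_of_basis : Module.FaithfullyFlat C₀ C`** (= conjunct 2 of the sheet's (A));
* **`ker_productMap_eq_span_of_basis : RingHom.ker θ = Ideal.span {c ⊗ 1 − 1 ⊗ c | c ∈ C₀}`** (= conjunct 3 of the sheet's (A), its text VERBATIM): every
  `w ∈ C ⊗[R] C` is `≡ Σ uᵢ ⊗ xᵢ` modulo that ideal, and `θ (Σ uᵢ ⊗ xᵢ) = Σ uᵢ • β i` detects `u`.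
So (A) holds for `(C, ρ)` AS SOON AS a `ρ`-basis `x` exists; §D produces one Zariski∕fpqc-locally on `Spec C₀` (general position over an infinite residue
field, [StacksProject] Tag 03BM proof) and §E descends.  The criterion is also what a consumer with an explicit basis (a TRIVIAL torsor `C = C₀ ⊗ H`,
`x i = 1 ⊗ bᵢ`) calls directly.

## References
* [MumfordAV1970] D. Mumford, *Abelian Varieties* (1970), §12 Thm. 1 (A) and its proof pp. 111–115 (the `B`-basis chosen by Nakayama, then descent).
* [SGA3I] M. Demazure, A. Grothendieck (eds.), *SGA 3, Tome I*, Exp. V, Thm. 4.1 (iv) (free case: `p` finite locally free, `X₁ ≅ X₀ ×_Y X₀`).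
* [StacksProject] The Stacks Project, Tag 03C8 (Lemma: a basis of `B` over `s♯(A)` made of `t♯(xᵢ)` gives `A = ⨁ C xᵢ` and `B ≅ A ⊗_C A`), Tag 03BM.
-/

set_option autoImplicit false

namespace Literature.AlgebraicGeometry.GroupSchemes.FiniteFlatQuotientAffine

open TensorProduct Algebra.TensorProduct WithConv

/-! ## §C  The basis criterion -/

section BasisCriterion

variable {R : Type*} [CommRing R] {H : Type*} [CommRing H] [HopfAlgebra R H]
  {C : Type*} [CommRing C] [Algebra R C] (ρ : C →ₐ[R] C ⊗[R] H)
  {ι : Type*} (x : ι → C) (β : Module.Basis ι C (C ⊗[R] H))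

/-- The Galois twist `T` of `D ⊗ H` (`D = C ⊗[R] H`, `j = includeRight`, §A) carries `(includeLeft ⊗ id)(ρ c)` to `(ρ ⊗ id)(ρ c)`: by §B
`galoisTwist_map_includeLeft` the left side is `assoc⁻¹ ((id ⊗ Δ)(ρ c))`, which is `(ρ ⊗ id)(ρ c)` by `hcoassoc` («`t` is `s` twisted by the
inverse», [StacksProject] Tag 03BI, applied to `t♯ f`). [cite: StacksProject, Tag 03BI] -/
theorem galoisTwist_map_includeLeft_coaction
    (hcoassoc : ∀ c : C, TensorProduct.map LinearMap.id (Coalgebra.comul (R := R) (A := H)) (ρ c) =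
      TensorProduct.assoc R C H H (TensorProduct.map ρ.toLinearMap LinearMap.id (ρ c)))
    (c : C) :
    productMap (includeLeft : C ⊗[R] H →ₐ[R] (C ⊗[R] H) ⊗[R] H)
        ((Algebra.TensorProduct.map (includeRight : H →ₐ[R] C ⊗[R] H) (AlgHom.id R H)).comp
          (Bialgebra.comulAlgHom R H))
      (Algebra.TensorProduct.map (includeLeft : C →ₐ[R] C ⊗[R] H) (AlgHom.id R H) (ρ c)) =
    Algebra.TensorProduct.map ρ (AlgHom.id R H) (ρ c) := by
  rw [galoisTwist_map_includeLeft, hcoassoc c, LinearEquiv.symm_apply_apply]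
  rfl

/-- Base change of a `C`-basis `β` of `C ⊗[R] H` along `includeLeft : C → D = C ⊗[R] H`: the family `(includeLeft ⊗ id)(β i)` is a `D`-basis of
`D ⊗[R] H` (Mathlib `Module.Basis.baseChange` transported along `Algebra.TensorProduct.cancelBaseChange : D ⊗[C] (C ⊗[R] H) ≃ D ⊗[R] H`; this is the
pull-back of the iso `⨁ A xᵢ ≅ B` along `s♯` in [StacksProject] Tag 03C8's diagram). [cite: StacksProject, Tag 03C8] -/
theorem exists_basis_map_includeLeft :
    ∃ γ : Module.Basis ι (C ⊗[R] H) ((C ⊗[R] H) ⊗[R] H),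
      ∀ i, γ i = Algebra.TensorProduct.map (includeLeft : C →ₐ[R] C ⊗[R] H) (AlgHom.id R H) (β i) := by
  let e : (C ⊗[R] H) ⊗[C] (C ⊗[R] H) ≃ₗ[C ⊗[R] H] (C ⊗[R] H) ⊗[R] H :=
    (Algebra.TensorProduct.cancelBaseChange R C (C ⊗[R] H) (C ⊗[R] H) H).toLinearEquiv
  refine ⟨(β.baseChange (C ⊗[R] H)).map e, fun i => ?_⟩
  rw [Module.Basis.map_apply, Module.Basis.baseChange_apply]
  -- e (1 ⊗ β i) = map includeLeft id (β i)
  induction β i using TensorProduct.induction_on with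
  | zero => simp [e]
  | tmul c h => simp [e, Algebra.TensorProduct.cancelBaseChange_tmul, Algebra.smul_def]
  | add u v hu hv => simp only [tmul_add, map_add, hu, hv]

/-- Base change of the `C`-basis `ρ (x i)` of `C ⊗[R] H` along `ρ : C → D = C ⊗[R] H`: the family `(ρ ⊗ id)(ρ (x i))` is a `D`-basis of `D ⊗[R] H`
(= the `includeLeft`-base-change basis of `exists_basis_map_includeLeft` mapped by the `D`-linear Galois automorphism `T` of §A, using
`galoisTwist_map_includeLeft_coaction`; the pull-back of `⨁ A xᵢ ≅ B` along `t♯` in [StacksProject] Tag 03C8's diagram, WITHOUT knowing `t♯` flat).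
[cite: StacksProject, Tag 03C8] -/
theorem exists_basis_map_coaction (hβ : ∀ i, β i = ρ (x i))
    (hcoassoc : ∀ c : C, TensorProduct.map LinearMap.id (Coalgebra.comul (R := R) (A := H)) (ρ c) =
      TensorProduct.assoc R C H H (TensorProduct.map ρ.toLinearMap LinearMap.id (ρ c))) :
    ∃ γ : Module.Basis ι (C ⊗[R] H) ((C ⊗[R] H) ⊗[R] H),
      ∀ i, γ i = Algebra.TensorProduct.map ρ (AlgHom.id R H) (ρ (x i)) := by
  obtain ⟨γ, hγ⟩ := exists_basis_map_includeLeft β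
  set T := productMap (includeLeft : C ⊗[R] H →ₐ[R] (C ⊗[R] H) ⊗[R] H)
        ((Algebra.TensorProduct.map (includeRight : H →ₐ[R] C ⊗[R] H) (AlgHom.id R H)).comp
          (Bialgebra.comulAlgHom R H)) with hT
  let e : ((C ⊗[R] H) ⊗[R] H) ≃ₗ[C ⊗[R] H] ((C ⊗[R] H) ⊗[R] H) :=
    LinearEquiv.ofBijective
      ({ toFun := T, map_add' := map_add T,
         map_smul' := galoisTwist_smul (includeRight : H →ₐ[R] C ⊗[R] H) } :
        ((C ⊗[R] H) ⊗[R] H) →ₗ[C ⊗[R] H] ((C ⊗[R] H) ⊗[R] H))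
      (galoisTwist_bijective (includeRight : H →ₐ[R] C ⊗[R] H))
  refine ⟨γ.map e, fun i => ?_⟩
  rw [Module.Basis.map_apply, hγ, hβ]
  exact galoisTwist_map_includeLeft_coaction ρ hcoassoc (x i)

/-- **The coordinates of `ρ c` in the `C`-basis `ρ (x i)` of `C ⊗[R] H` lie in the invariants `C₀ = AlgHom.equalizer ρ includeLeft`**
([StacksProject] Tag 03C8, the right vertical arrow: «`A = ⨁ C xᵢ`»): apply the algebra maps `u₀ = ρ ⊗ id` and `u₁ = T ∘ (includeLeft ⊗ id)` to
`ρ c = Σ aᵢ • ρ (x i)`; `u₀ (ρ c) = u₁ (ρ c)` (coassociativity), `u₀`, `u₁` send `ρ (x i)` to the same `D`-basis vector `γ i` and the scalar `aᵢ` to `ρ aᵢ`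
resp. `aᵢ ⊗ 1`; compare `γ`-coordinates. [cite: StacksProject, Tag 03C8] -/
theorem repr_coaction_mem_equalizer (hβ : ∀ i, β i = ρ (x i))
    (hcoassoc : ∀ c : C, TensorProduct.map LinearMap.id (Coalgebra.comul (R := R) (A := H)) (ρ c) =
      TensorProduct.assoc R C H H (TensorProduct.map ρ.toLinearMap LinearMap.id (ρ c)))
    (c : C) (i : ι) :
    β.repr (ρ c) i ∈ AlgHom.equalizer ρ (includeLeft : C →ₐ[R] C ⊗[R] H) := by
  classical
  rw [AlgHom.mem_equalizer]
  obtain ⟨γ, hγ⟩ := exists_basis_map_coaction ρ x β hβ hcoassoc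
  set a := β.repr (ρ c) with ha
  have hc : ρ c = a.sum fun j b => b • β j := by rw [ha]; exact (β.linearCombination_repr (ρ c)).symm
  set u₀ := Algebra.TensorProduct.map ρ (AlgHom.id R H) with hu₀
  set u₁ := (productMap (includeLeft : C ⊗[R] H →ₐ[R] (C ⊗[R] H) ⊗[R] H)
        ((Algebra.TensorProduct.map (includeRight : H →ₐ[R] C ⊗[R] H) (AlgHom.id R H)).comp
          (Bialgebra.comulAlgHom R H))).comp
      (Algebra.TensorProduct.map (includeLeft : C →ₐ[R] C ⊗[R] H) (AlgHom.id R H)) with hu₁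
  have hsm : ∀ (a : C) (z : C ⊗[R] H), u₀ (a • z) = (ρ a) • u₀ z := by
    intro a z
    simp only [Algebra.smul_def, Algebra.TensorProduct.algebraMap_apply, Algebra.algebraMap_self, RingHom.id_apply,
      map_mul, hu₀, Algebra.TensorProduct.map_tmul, map_one]
  have hsm' : ∀ (a : C) (z : C ⊗[R] H), u₁ (a • z) = ((includeLeft : C →ₐ[R] C ⊗[R] H) a) • u₁ z := by
    intro a z
    simp only [Algebra.smul_def, Algebra.TensorProduct.algebraMap_apply, Algebra.algebraMap_self, RingHom.id_apply,
      map_mul, hu₁, AlgHom.comp_apply, Algebra.TensorProduct.map_tmul, map_one,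
      Algebra.TensorProduct.includeLeft_apply, productMap_apply_tmul, mul_one]
  have h01 : u₀ (ρ c) = u₁ (ρ c) := by
    rw [hu₁, AlgHom.comp_apply]; exact (galoisTwist_map_includeLeft_coaction ρ hcoassoc c).symm
  have hγ₀ : ∀ j, u₀ (β j) = γ j := fun j => by rw [hγ, hβ]
  have hγ₁ : ∀ j, u₁ (β j) = γ j := fun j => by
    rw [hγ, hu₁, AlgHom.comp_apply, hβ]; exact galoisTwist_map_includeLeft_coaction ρ hcoassoc (x j)
  have hsum₀ : u₀ (ρ c) = Finsupp.linearCombination (C ⊗[R] H) γ (a.mapRange ρ (map_zero ρ)) := by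
    rw [hc, map_finsuppSum, Finsupp.linearCombination_apply, Finsupp.sum_mapRange_index (h := fun j d => d • γ j) (fun j => zero_smul _ _)]
    simp only [hsm, hγ₀]
  have hsum₁ : u₁ (ρ c) = Finsupp.linearCombination (C ⊗[R] H) γ
      (a.mapRange (includeLeft : C →ₐ[R] C ⊗[R] H) (map_zero (includeLeft : C →ₐ[R] C ⊗[R] H))) := by
    rw [hc, map_finsuppSum, Finsupp.linearCombination_apply, Finsupp.sum_mapRange_index (h := fun j d => d • γ j) (fun j => zero_smul _ _)]
    simp only [hsm', hγ₁]
  have key := congr_arg (fun z => γ.repr z i) h01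
  simp only [hsum₀, hsum₁, Module.Basis.repr_linearCombination, Finsupp.mapRange_apply] at key
  exact key

/-- `c = Σᵢ (β.repr (ρ c) i) · x i`: apply the counit section `ε_C = rid ∘ (id ⊗ ε) : C ⊗[R] H →ₐ[C] C` (`hcounit`, §B `rid_comp_map_counit_apply`) to
the expansion `ρ c = Σ aᵢ • ρ (x i)`. [cite: StacksProject, Tag 03C8] -/
theorem eq_sum_repr_coaction_mul (hβ : ∀ i, β i = ρ (x i))
    (hcounit : ∀ c : C, TensorProduct.rid R C
      (TensorProduct.map LinearMap.id (Coalgebra.counit (R := R) (A := H)) (ρ c)) = c)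
    (c : C) : c = (β.repr (ρ c)).sum fun i b => b * x i := by
  set εC : C ⊗[R] H →ₐ[C] C := (Algebra.TensorProduct.rid R C C).toAlgHom.comp
      (Algebra.TensorProduct.map (AlgHom.id C C) (Bialgebra.counitAlgHom R H)) with hεC
  have h1 : ∀ c, εC (ρ c) = c := fun c => by rw [hεC, rid_comp_map_counit_apply, hcounit]
  have hc : ρ c = (β.repr (ρ c)).sum fun j b => b • β j := (β.linearCombination_repr (ρ c)).symm
  calc c = εC (ρ c) := (h1 c).symm
    _ = εC ((β.repr (ρ c)).sum fun j b => b • β j) := by rw [← hc]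
    _ = (β.repr (ρ c)).sum fun j b => εC (b • β j) := map_finsuppSum εC _ _
    _ = (β.repr (ρ c)).sum fun i b => b * x i :=
        Finsupp.sum_congr fun j _ => by rw [map_smul, hβ, h1, smul_eq_mul]

/-- The family `x` SPANS `C` over `C₀` (`eq_sum_repr_coaction_mul` with the invariant coefficients of `repr_coaction_mem_equalizer`).
[cite: StacksProject, Tag 03C8] -/
theorem span_invariants_range_eq_top (hβ : ∀ i, β i = ρ (x i))
    (hcoassoc : ∀ c : C, TensorProduct.map LinearMap.id (Coalgebra.comul (R := R) (A := H)) (ρ c) =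
      TensorProduct.assoc R C H H (TensorProduct.map ρ.toLinearMap LinearMap.id (ρ c)))
    (hcounit : ∀ c : C, TensorProduct.rid R C
      (TensorProduct.map LinearMap.id (Coalgebra.counit (R := R) (A := H)) (ρ c)) = c) :
    Submodule.span (AlgHom.equalizer ρ (includeLeft : C →ₐ[R] C ⊗[R] H)) (Set.range x) = ⊤ := by
  rw [eq_top_iff]
  intro c _
  rw [eq_sum_repr_coaction_mul ρ x β hβ hcounit c]
  refine Submodule.sum_mem _ fun j _ => ?_
  have hmem := repr_coaction_mem_equalizer ρ x β hβ hcoassoc c j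
  have : β.repr (ρ c) j * x j =
      (⟨β.repr (ρ c) j, hmem⟩ : AlgHom.equalizer ρ (includeLeft : C →ₐ[R] C ⊗[R] H)) • x j := rfl
  change β.repr (ρ c) j * x j ∈ _
  rw [this]
  exact Submodule.smul_mem _ _ (Submodule.subset_span ⟨j, rfl⟩)

/-- The family `x` is LINEARLY INDEPENDENT over `C₀`: `ρ (Σ bᵢ xᵢ) = Σ bᵢ • ρ (x i)` for invariant `bᵢ` (`ρ bᵢ = bᵢ ⊗ 1`), and `ρ (x i)` is a `C`-basis.
[cite: StacksProject, Tag 03C8] -/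
theorem linearIndependent_invariants (hβ : ∀ i, β i = ρ (x i)) :
    LinearIndependent (AlgHom.equalizer ρ (includeLeft : C →ₐ[R] C ⊗[R] H)) x := by
  classical
  rw [linearIndependent_iff']
  intro s g hg i hi
  have hρ : ρ (∑ i ∈ s, g i • x i) = ∑ i ∈ s, ((g i : C)) • β i := by
    rw [map_sum]
    refine Finset.sum_congr rfl fun j _ => ?_
    have hgj : ρ (g j : C) = (g j : C) ⊗ₜ[R] 1 := (AlgHom.mem_equalizer _ _ _).1 (g j).2
    rw [show g j • x j = (g j : C) * x j from rfl, map_mul, hgj, hβ, Algebra.smul_def,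
      Algebra.TensorProduct.algebraMap_apply, Algebra.algebraMap_self, RingHom.id_apply]
  rw [hg, map_zero] at hρ
  have := (linearIndependent_iff'.1 β.linearIndependent) s (fun j => (g j : C)) hρ.symm i hi
  exact Subtype.ext this

/-- **[StacksProject] Lemma 03C8 in Hopf form: if `ρ (x i)` is a `C`-basis of `C ⊗[R] H` then `x` is a `C₀`-basis of `C`** («`B = ⨁ s♯(A) t♯(xᵢ)` ⇒
`A = ⨁ C xᵢ`»), for any commutative Hopf algebra `H` and any coassociative counital coaction. [cite: StacksProject, Tag 03C8] -/
theorem exists_basis_invariants (hβ : ∀ i, β i = ρ (x i))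
    (hcoassoc : ∀ c : C, TensorProduct.map LinearMap.id (Coalgebra.comul (R := R) (A := H)) (ρ c) =
      TensorProduct.assoc R C H H (TensorProduct.map ρ.toLinearMap LinearMap.id (ρ c)))
    (hcounit : ∀ c : C, TensorProduct.rid R C
      (TensorProduct.map LinearMap.id (Coalgebra.counit (R := R) (A := H)) (ρ c)) = c) :
    ∃ β₀ : Module.Basis ι (AlgHom.equalizer ρ (includeLeft : C →ₐ[R] C ⊗[R] H)) C, ∀ i, β₀ i = x i :=
  ⟨Module.Basis.mk (linearIndependent_invariants ρ x β hβ)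
      (span_invariants_range_eq_top ρ x β hβ hcoassoc hcounit).ge,
    fun i => Module.Basis.mk_apply _ _ i⟩

/-- `C` is a FREE `C₀`-module as soon as `C ⊗[R] H` has a `C`-basis of the form `ρ (x i)`. [cite: StacksProject, Tag 03C8] -/
theorem free_invariants_of_basis (hβ : ∀ i, β i = ρ (x i))
    (hcoassoc : ∀ c : C, TensorProduct.map LinearMap.id (Coalgebra.comul (R := R) (A := H)) (ρ c) =
      TensorProduct.assoc R C H H (TensorProduct.map ρ.toLinearMap LinearMap.id (ρ c)))
    (hcounit : ∀ c : C, TensorProduct.rid R C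
      (TensorProduct.map LinearMap.id (Coalgebra.counit (R := R) (A := H)) (ρ c)) = c) :
    Module.Free (AlgHom.equalizer ρ (includeLeft : C →ₐ[R] C ⊗[R] H)) C := by
  obtain ⟨β₀, -⟩ := exists_basis_invariants ρ x β hβ hcoassoc hcounit
  exact Module.Free.of_basis β₀

/-- `C` is a FINITE `C₀`-module as soon as `C ⊗[R] H` has a finite `C`-basis of the form `ρ (x i)` ([MumfordAV1970] §12 Thm. 1 (A) «`π` finite, locally free
of rank `= rk Z`»). [cite: MumfordAV1970, §12 Thm. 1 (A) p. 111] -/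
theorem finite_invariants_of_basis [Finite ι] (hβ : ∀ i, β i = ρ (x i))
    (hcoassoc : ∀ c : C, TensorProduct.map LinearMap.id (Coalgebra.comul (R := R) (A := H)) (ρ c) =
      TensorProduct.assoc R C H H (TensorProduct.map ρ.toLinearMap LinearMap.id (ρ c)))
    (hcounit : ∀ c : C, TensorProduct.rid R C
      (TensorProduct.map LinearMap.id (Coalgebra.counit (R := R) (A := H)) (ρ c)) = c) :
    Module.Finite (AlgHom.equalizer ρ (includeLeft : C →ₐ[R] C ⊗[R] H)) C := by
  obtain ⟨β₀, -⟩ := exists_basis_invariants ρ x β hβ hcoassoc hcounit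
  exact Module.Finite.of_basis β₀

/-- **`C` is FAITHFULLY FLAT over `C₀`** as soon as `C ⊗[R] H` has a `C`-basis of the form `ρ (x i)` (free, and nonzero unless `C = 0 = C₀`; conjunct 2 of
«FFGS-QUOT» (A); [SGA3I] V Thm. 4.1 (iv) «`p` est fidèlement plat», [MumfordAV1970] §12 Thm. 1 (A)). [cite: SGA3I, Exp. V Thm. 4.1 (iv)] -/
theorem faithfullyFlat_invariants_of_basis (hβ : ∀ i, β i = ρ (x i))
    (hcoassoc : ∀ c : C, TensorProduct.map LinearMap.id (Coalgebra.comul (R := R) (A := H)) (ρ c) =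
      TensorProduct.assoc R C H H (TensorProduct.map ρ.toLinearMap LinearMap.id (ρ c)))
    (hcounit : ∀ c : C, TensorProduct.rid R C
      (TensorProduct.map LinearMap.id (Coalgebra.counit (R := R) (A := H)) (ρ c)) = c) :
    Module.FaithfullyFlat (AlgHom.equalizer ρ (includeLeft : C →ₐ[R] C ⊗[R] H)) C := by
  haveI := free_invariants_of_basis ρ x β hβ hcoassoc hcounit
  rcases subsingleton_or_nontrivial C with hC | hC
  · haveI : Subsingleton (AlgHom.equalizer ρ (includeLeft : C →ₐ[R] C ⊗[R] H)) := inferInstance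
    refine ⟨fun m hm => False.elim (hm.ne_top ((Ideal.eq_top_iff_one m).2 ?_))⟩
    rw [Subsingleton.elim (1 : AlgHom.equalizer ρ (includeLeft : C →ₐ[R] C ⊗[R] H)) 0]
    exact m.zero_mem
  · infer_instance

/-- **The torsor clause `X ×_Y X ≅ X × Z` in ring form: the kernel of the Galois map `θ = productMap includeLeft ρ : C ⊗[R] C → C ⊗[R] H` is the ideal
generated by the `c ⊗ 1 − 1 ⊗ c`, `c ∈ C₀`** (so `θ` induces `C ⊗_{C₀} C ⥲ image`; conjunct 3 of «FFGS-QUOT» (A), text VERBATIM from the signature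
sheet), as soon as `C ⊗[R] H` has a `C`-basis `ρ (x i)` ([StacksProject] Tag 03C8 «`B ≅ A ⊗_C A`»; [SGA3I] V 4.1 (iv) «`X₁ ⥲ X₀ ×_Y X₀`»): every tensor is
`≡ Σ uᵢ ⊗ xᵢ` modulo the ideal (expand the right factor in the `C₀`-basis `x`), and `θ (Σ uᵢ ⊗ xᵢ) = Σ uᵢ • ρ (x i)` vanishes only for `u = 0`.
[cite: StacksProject, Tag 03C8] -/
theorem ker_productMap_eq_span_of_basis (hβ : ∀ i, β i = ρ (x i))
    (hcoassoc : ∀ c : C, TensorProduct.map LinearMap.id (Coalgebra.comul (R := R) (A := H)) (ρ c) =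
      TensorProduct.assoc R C H H (TensorProduct.map ρ.toLinearMap LinearMap.id (ρ c)))
    (hcounit : ∀ c : C, TensorProduct.rid R C
      (TensorProduct.map LinearMap.id (Coalgebra.counit (R := R) (A := H)) (ρ c)) = c) :
    RingHom.ker (Algebra.TensorProduct.productMap
        (Algebra.TensorProduct.includeLeft : C →ₐ[R] C ⊗[R] H) ρ).toRingHom =
      Ideal.span {w : C ⊗[R] C | ∃ c ∈ AlgHom.equalizer ρ
        (Algebra.TensorProduct.includeLeft : C →ₐ[R] C ⊗[R] H), w = c ⊗ₜ[R] (1 : C) - (1 : C) ⊗ₜ[R] c} := by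
  classical
  set θ := Algebra.TensorProduct.productMap (Algebra.TensorProduct.includeLeft : C →ₐ[R] C ⊗[R] H) ρ
    with hθ
  set J : Ideal (C ⊗[R] C) := Ideal.span {w : C ⊗[R] C | ∃ c ∈ AlgHom.equalizer ρ
        (Algebra.TensorProduct.includeLeft : C →ₐ[R] C ⊗[R] H), w = c ⊗ₜ[R] (1 : C) - (1 : C) ⊗ₜ[R] c}
    with hJ
  -- `J ≤ ker θ`
  have hJle : J ≤ RingHom.ker θ.toRingHom := by
    rw [hJ, Ideal.span_le]
    rintro _ ⟨c, hc, rfl⟩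
    rw [SetLike.mem_coe, RingHom.mem_ker, AlgHom.toRingHom_eq_coe, AlgHom.coe_toRingHom, map_sub,
      hθ, productMap_apply_tmul, productMap_apply_tmul, map_one, map_one, mul_one, one_mul,
      (AlgHom.mem_equalizer _ _ _).1 hc, sub_self]
  refine le_antisymm ?_ hJle
  -- every `w` is congruent mod `J` to some `Σ uᵢ ⊗ xᵢ`
  have key : ∀ w : C ⊗[R] C, ∃ u : ι →₀ C, w - u.sum (fun i b => b ⊗ₜ[R] x i) ∈ J := by
    intro w
    induction w using TensorProduct.induction_on with
    | zero => exact ⟨0, by simp⟩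
    | tmul a c =>
        refine ⟨(β.repr (ρ c)).mapRange (fun b => a * b) (mul_zero a), ?_⟩
        rw [Finsupp.sum_mapRange_index (h := fun i b => b ⊗ₜ[R] x i) (fun i => zero_tmul _ _),
          show a ⊗ₜ[R] c = a ⊗ₜ[R] ((β.repr (ρ c)).sum fun i b => b * x i) from
            congrArg (fun z => a ⊗ₜ[R] z) (eq_sum_repr_coaction_mul ρ x β hβ hcounit c)]
        rw [Finsupp.sum, Finsupp.sum, tmul_sum, ← Finset.sum_sub_distrib]
        refine J.sum_mem fun j _ => ?_
        have hgen : β.repr (ρ c) j ⊗ₜ[R] (1 : C) - (1 : C) ⊗ₜ[R] β.repr (ρ c) j ∈ J :=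
          Ideal.subset_span ⟨_, repr_coaction_mem_equalizer ρ x β hβ hcoassoc c j, rfl⟩
        have : a ⊗ₜ[R] (β.repr (ρ c) j * x j) - (a * β.repr (ρ c) j) ⊗ₜ[R] x j =
            -((a ⊗ₜ[R] x j) * (β.repr (ρ c) j ⊗ₜ[R] (1 : C) - (1 : C) ⊗ₜ[R] β.repr (ρ c) j)) := by
          simp only [mul_sub, Algebra.TensorProduct.tmul_mul_tmul, mul_one, one_mul, mul_comm (x j), neg_sub]
        rw [this]
        exact J.neg_mem (J.mul_mem_left _ hgen)
    | add w₁ w₂ h₁ h₂ =>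
        obtain ⟨u₁, hu₁⟩ := h₁
        obtain ⟨u₂, hu₂⟩ := h₂
        refine ⟨u₁ + u₂, ?_⟩
        rw [Finsupp.sum_add_index' (h := fun i b => b ⊗ₜ[R] x i) (fun i => zero_tmul _ _)
          (fun i b₁ b₂ => add_tmul _ _ _)]
        have : w₁ + w₂ - (u₁.sum (fun i b => b ⊗ₜ[R] x i) + u₂.sum (fun i b => b ⊗ₜ[R] x i)) =
            (w₁ - u₁.sum (fun i b => b ⊗ₜ[R] x i)) + (w₂ - u₂.sum (fun i b => b ⊗ₜ[R] x i)) := by abel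
        rw [this]
        exact J.add_mem hu₁ hu₂
  -- `θ (Σ uᵢ ⊗ xᵢ) = Σ uᵢ • β i`
  have hθu : ∀ u : ι →₀ C, θ (u.sum (fun i b => b ⊗ₜ[R] x i)) = Finsupp.linearCombination C β u := by
    intro u
    rw [map_finsuppSum, Finsupp.linearCombination_apply]
    refine Finsupp.sum_congr fun j _ => ?_
    rw [hθ, productMap_apply_tmul, ← hβ, Algebra.smul_def, Algebra.TensorProduct.algebraMap_apply,
      Algebra.algebraMap_self, RingHom.id_apply, Algebra.TensorProduct.includeLeft_apply]
  intro w hw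
  obtain ⟨u, hu⟩ := key w
  have h0 : θ (u.sum (fun i b => b ⊗ₜ[R] x i)) = 0 := by
    have h1 : θ (w - u.sum (fun i b => b ⊗ₜ[R] x i)) = 0 := hJle hu
    rw [map_sub, show θ w = 0 from hw, zero_sub, neg_eq_zero] at h1
    exact h1
  rw [hθu] at h0
  have hu0 : u = 0 := by
    have := congr_arg β.repr h0
    rwa [Module.Basis.repr_linearCombination, map_zero] at this
  rw [hu0, Finsupp.sum_zero_index, sub_zero] at hu
  exact hu

end BasisCriterion

end Literature.AlgebraicGeometry.GroupSchemes.FiniteFlatQuotientAffine
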